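import Summits.QuantumFields.YangMills.Theorems.IR.VacuumEscapePhysicalTimeArith
import Summits.QuantumFields.YangMills.Theorems.IR.VacuumEscapeCheeger
import HarnessLib

/-!
# Line `vacuum_escape` (crux `BalabanLadder.IR`, stmt-QuantumFields-19354) — physical-time currency, part 3b:
# the `n`-step Cheeger seam on one torus

One-torus form of `PhysicalTimeConductance ⇒ SliceGapInUnits` (census B6; pooled prover ym-ir-line-pool-p3): if every measurable slice event `A` of
the spatial torus `(2S+1)³` satisfies `k·mass_m(A)(1 − mass_m(A)) ≤ mass_m(A) − stay_m^{(n)}(A)` for all large temporal extents, then the trace excess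
decays at rate `k²/(8n)` (`traceExcess_le_of_lagConductance`).  Proof: the `n`-step slice-chain probabilities are normalised spectral sums of Lüscher's
transfer matrix (part 2 `hasSum_cyclic_insert_lag` for `sliceStayN`, the tree's `hasSum_cyclic_insert_fg` for `sliceMass`); as `m → ∞` the hypothesis
becomes the conductance bound `k·P(1−P) ≤ P − λ₀^{−n}∫_A∫_A h K⁽ⁿ⁾ h` of the ground-state transform of the ITERATED kernel `K⁽ⁿ⁾` (part 1), to which
the tree's `GroundState.eigenvalue_le_of_conductance` (Lawler–Sokal Thm 2.1) applies with the operator `Aⁿ`: `λᵢⁿ ≤ λ₀ⁿ(1 − k²/8)` off the vacuum, so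
`λᵢ/λ₀ ≤ (1 − k²/8)^{1/n} ≤ e^{−k²/(8n)}` and `x_t ≤ x₂ e^{k²/(4n)} e^{−(k²/(8n)) t}`.  [Lawler–Sokal 1988 Thm 2.1; Osterwalder–Seiler 1978 §3]

HONEST FRAMING: a format equivalence between two typed currencies of ONE line of an open crux of a CONDITIONAL chain; the content of the line
(the LOAD `stub_noStickySliceEvent`, weak-coupling volume-uniform isoperimetry) is untouched; nothing here proves `BalabanLadder.IR`, a lattice
gap, or the Yang–Mills mass gap (Clay); R4 of the ladder closes only `BalabanLadder.UV`.
-/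

set_option autoImplicit false

noncomputable section

open MeasureTheory Filter Set Function
open scoped RealInnerProductSpace ENNReal Topology
open Literature.Analysis.OperatorTheory Literature.MathematicalPhysics.QuantumFieldTheory
open Summit.QuantumFields.YangMills.Cruxes.IR.VacuumEscape.Spectral Summit.QuantumFields.YangMills.Cruxes.IR.VacuumEscape.GroundState
open Summit.QuantumFields.YangMills.Cruxes.IR.VacuumEscape.IterKernel Summit.QuantumFields.YangMills.Cruxes.IR.VacuumEscape.LagSpectral

namespace Summit.QuantumFields.YangMills.Cruxes.IR.VacuumEscape

section PerTorus

variable {G : Type} [Group G] [TopologicalSpace G] [IsTopologicalGroup G] [CompactSpace G] [MeasurableSpace G] [BorelSpace G]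
  [SecondCountableTopology G] {n : ℕ} {ρ : G →* Matrix (Fin n) (Fin n) ℂ}

/-- **The `n`-step Cheeger seam on one torus** (`n = r + 1`).  For continuous unitary `ρ`, `β ≥ 0`, a spatial torus `(2S+1)³` and `k ≥ 0`: if every
measurable slice event `A` satisfies `k·mass_m(A)(1 − mass_m(A)) ≤ mass_m(A) − stay_m^{(r+1)}(A)` for all large temporal extents `m + 2`, then
`x_t ≤ K e^{−(k²/(8(r+1))) t}` for all `t ≥ 2`. -/
theorem traceExcess_le_of_lagConductance (hρ : Continuous ρ) (hρu : ∀ g, ρ g ∈ Matrix.unitaryGroup (Fin n) ℂ)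
    {β : ℝ} (hβ : 0 ≤ β) (S : ℕ) {k : ℝ} (hk : 0 ≤ k) (r : ℕ)
    (hcond : ∀ A : Set (GaugeConfig 3 (2 * S + 1) G), MeasurableSet A → ∃ m₀ : ℕ, ∀ m : ℕ, m₀ ≤ m →
      k * (sliceMass ρ β (2 * S + 1) (m + 2) A * (1 - sliceMass ρ β (2 * S + 1) (m + 2) A)) ≤
        sliceMass ρ β (2 * S + 1) (m + 2) A - sliceStayN ρ β (2 * S + 1) (m + 2) (r + 1) A) :
    ∃ Kc : ℝ, ∀ m : ℕ, traceExcess ρ β (2 * S + 1) (m + 2) ≤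
      Kc * Real.exp (-(k ^ 2 / (8 * ((r : ℝ) + 1)) * ((m + 2 : ℕ) : ℝ))) := by
  classical
  set N : ℕ := 2 * S + 1 with hN
  set μ : Measure (GaugeConfig 3 N G) := Measure.pi fun _ : Edge 3 N => haarProbability G with hμ
  set K : GaugeConfig 3 N G → GaugeConfig 3 N G → ℝ := wilsonSliceKernel ρ β with hKdef
  set A := wilsonTorusTransferMatrix ρ β N with hAdef
  -- kernel facts
  have hK : StronglyMeasurable (uncurry K) := stronglyMeasurable_uncurry_wilsonSliceKernel ρ hρ β
  have hKm : Measurable (uncurry K) := hK.measurable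
  obtain ⟨C, hC⟩ := exists_norm_wilsonSliceKernel_le (L := N) ρ hρ β
  have hsymm : ∀ x y, K x y = K y x := wilsonSliceKernel_symm ρ hρu β
  have hpos : ∀ x y, 0 < K x y := wilsonSliceKernel_pos ρ hρ β
  obtain ⟨κ₀, hκ₀, hKmin⟩ : ∃ κ₀ : ℝ, 0 < κ₀ ∧ ∀ U U' : GaugeConfig 3 N G, κ₀ ≤ K U U' := by
    have hcont := continuous_uncurry_wilsonSliceKernel (L := N) ρ hρ β
    obtain ⟨p, -, hp⟩ := isCompact_univ.exists_isMinOn univ_nonempty hcont.continuousOn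
    exact ⟨K p.1 p.2, hpos p.1 p.2, fun U U' => (isMinOn_iff.mp hp) (U, U') (mem_univ _)⟩
  have hKnn : ∀ x y, 0 ≤ K x y := fun x y => (hpos x y).le
  have hAker : ∀ φ : Lp ℝ 2 μ, (A φ : GaugeConfig 3 N G → ℝ) =ᵐ[μ] fun U => ∫ U', K U U' * φ U' ∂μ :=
    wilsonTorusTransferMatrix_ae_eq β N hρ
  have hsa : IsSelfAdjoint A := isSelfAdjoint_wilsonTorusTransferMatrix N hρ hρu β
  have hcpt : IsCompactOperator A := isCompactOperator_wilsonTorusTransferMatrix β N hρ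
  have himp : IsPositivityImproving A := isPositivityImproving_wilsonTorusTransferMatrix β N hρ
  have hA0 : A ≠ 0 := wilsonTorusTransferMatrix_ne_zero β N hρ
  -- the iterated kernels
  set Kn : ℕ → GaugeConfig 3 N G → GaugeConfig 3 N G → ℝ :=
    fun j x y => (fun f : GaugeConfig 3 N G → ℝ => fun w => ∫ z, K w z * f z ∂μ)^[j] (fun z => K z y) x with hKn
  have hK0 : Kn 0 = K := rfl
  have hKs : ∀ j x y, Kn (j + 1) x y = ∫ z, K x z * Kn j z y ∂μ := by
    intro j x y
    simp only [hKn, Function.iterate_succ_apply']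
  obtain ⟨hKnm, hKnb⟩ := measurable_bdd_iterK (μ := μ) hKm hC hK0 hKs r
  have hKn' : StronglyMeasurable (uncurry (Kn r)) := hKnm.stronglyMeasurable
  have hsymmn : ∀ x y, Kn r x y = Kn r y x := iterK_symm (μ := μ) hKm hC hsymm hK0 hKs r
  have hKnnn : ∀ x y, 0 ≤ Kn r x y := iterK_nonneg (μ := μ) hKnn hK0 hKs r
  have hAkern : ∀ φ : Lp ℝ 2 μ, ((A ^ (r + 1)) φ : GaugeConfig 3 N G → ℝ) =ᵐ[μ] fun U => ∫ U', Kn r U U' * φ U' ∂μ :=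
    pow_opKernel (μ := μ) hKm hC hK0 hKs hAker r
  -- spectral data and the trace formula
  obtain ⟨s, hs, b, lam, i₀, hb, hle, hL0, hi₀, hS2, hrad, hZ⟩ :=
    exists_spectralData_wilsonTorusTransferMatrix N hρ hρu hβ
  haveI : Countable s := hs
  have hlam0 : ∀ i, 0 ≤ lam i := fun i => (hle i).1
  -- ground-state data
  obtain ⟨h, B, h₀, θ, hhm, hhB, hh₀, hlow, heig, hnorm, ⟨ε, hε2, hbε⟩, horth, hθ0, hθ, hgapl⟩ :=
    exists_groundState_data (μ := μ) hK hC hsymm hpos hκ₀ hKmin hAker hsa hcpt himp hA0 hb hlam0 hi₀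
  -- ratios
  set lam₀ : ℝ := lam i₀ with hlam₀def
  set rr : s → ℝ := fun i => lam i / lam₀ with hr
  have hr0 : ∀ i, 0 ≤ rr i := fun i => div_nonneg (hlam0 i) hL0.le
  have hri₀ : rr i₀ = 1 := div_self hL0.ne'
  set ϑ : ℝ := θ / lam₀ with hϑ
  have hϑ1 : ϑ < 1 := (div_lt_one hL0).2 hθ
  have hrϑ : ∀ i, i ≠ i₀ → rr i ≤ ϑ := fun i hi => div_le_div_of_nonneg_right (hgapl i hi) hL0.le
  have hrsum : Summable fun i => rr i ^ 2 := by
    have := hS2.div_const (lam₀ ^ 2)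
    refine this.congr fun i => ?_
    rw [hr]; simp only; rw [div_pow]
  have hlam_eq : ∀ i (j : ℕ), lam i ^ j = lam₀ ^ j * rr i ^ j := fun i j => by
    rw [← mul_pow, hr]; simp only; rw [mul_div_cancel₀ _ hL0.ne']
  have hlamr : ∀ i, lam i = lam₀ * rr i := fun i => by rw [hr]; simp only; rw [mul_div_cancel₀ _ hL0.ne']
  have hL0n : 0 < lam₀ ^ (r + 1) := pow_pos hL0 _
  have heign : ∀ x, ∫ y, Kn r x y * h y ∂μ = lam₀ ^ (r + 1) * h x :=
    integral_iterK_mul_eigen (μ := μ) hKm hC hK0 hKs hhm hhB heig r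
  -- STEP 1: the `n`-step conductance bound of the ground-state chain, set by set
  have hconduct : ∀ Aset : Set (GaugeConfig 3 N G), MeasurableSet Aset →
      k * (∫ x in Aset, h x ^ 2 ∂μ) * (1 - ∫ x in Aset, h x ^ 2 ∂μ) ≤
        (∫ x in Aset, h x ^ 2 ∂μ) - (lam₀ ^ (r + 1))⁻¹ * ∫ x in Aset, ∫ y in Aset, h x * Kn r x y * h y ∂μ ∂μ := by
    intro Aset hAset
    obtain ⟨m₀, hm₀⟩ := hcond Aset hAset
    -- the indicator weight and the two insertion operators
    set f : GaugeConfig 3 N G → ℝ := Aset.indicator (fun _ => (1 : ℝ)) with hf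
    have hfm : Measurable f := measurable_const.indicator hAset
    have hf01 : ∀ x, f x = 0 ∨ f x = 1 := fun x => by
      by_cases hx : x ∈ Aset
      · right; simp [hf, hx]
      · left; simp [hf, hx]
    have hfb : ∀ x, ‖f x‖ ≤ 1 := fun x => by rcases hf01 x with h0 | h0 <;> simp [h0]
    have hone : ∀ x : GaugeConfig 3 N G, ‖(fun _ : GaugeConfig 3 N G => (1 : ℝ)) x‖ ≤ 1 := fun x => by simp
    have hX1m := stronglyMeasurable_fgKernel hK hfm (measurable_const : Measurable fun _ : GaugeConfig 3 N G => (1 : ℝ))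
    have hX1b := norm_fgKernel_le hC hfb hone
    obtain ⟨X1, hX1⟩ := exists_kernelOp (μ := μ) hX1m hX1b
    have hXnm := stronglyMeasurable_lagKernel (μ := μ) hKm hC hK0 hKs hfm hfm r
    have hXnb := norm_lagKernel_le (μ := μ) hKm hC hK0 hKs hfb hfb r
    obtain ⟨Xn, hXn⟩ := exists_kernelOp (μ := μ) hXnm hXnb
    -- coefficients
    set πc : s → ℝ := fun i => ∫ x, f x * (b i x) ^ 2 ∂μ with hπc
    set qc : s → ℝ := fun i => ⟪b i, Xn (b i)⟫ with hqc
    have hπb : ∀ i, |πc i| ≤ 1 := by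
      intro i
      have hsq : Integrable (fun x => (b i x) ^ 2) μ := (Lp.memLp (b i)).integrable_sq
      have h1 : ∫ x, (b i x) ^ 2 ∂μ = 1 := by
        have := inner_eq_integral (μ := μ) (b i) (b i)
        rw [real_inner_self_eq_norm_sq, b.orthonormal.norm_eq_one i, one_pow] at this
        rw [this]; refine integral_congr_ae (Eventually.of_forall fun x => ?_); ring
      have hnn : 0 ≤ πc i := integral_nonneg fun x => by
        rcases hf01 x with h0 | h0 <;> simp [h0, sq_nonneg]
      have hle1 : πc i ≤ 1 := by
        rw [← h1]
        refine integral_mono_of_nonneg (Eventually.of_forall fun x => ?_) hsq (Eventually.of_forall fun x => ?_)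
        · rcases hf01 x with h0 | h0 <;> simp [h0, sq_nonneg]
        · rcases hf01 x with h0 | h0 <;> simp [h0, sq_nonneg]
      rw [abs_of_nonneg hnn]; exact hle1
    have hqb : ∀ i, |qc i| ≤ ‖Xn‖ := fun i => by
      calc |qc i| ≤ ‖b i‖ * ‖Xn (b i)‖ := abs_real_inner_le_norm _ _
        _ ≤ ‖b i‖ * (‖Xn‖ * ‖b i‖) := mul_le_mul_of_nonneg_left (Xn.le_opNorm _) (norm_nonneg _)
        _ = ‖Xn‖ := by rw [b.orthonormal.norm_eq_one i]; ring
    -- the slice-chain probabilities as normalised spectral sums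
    have hmass : ∀ M : ℕ, sliceMass ρ β N (M + 1 + 2) Aset =
        (∑' i, rr i ^ (M + 1 + 2) * πc i) / (∑' i, rr i ^ (M + 1 + 2)) := by
      intro M
      have hS := hasSum_cyclic_insert_fg (μ := μ) hK hC hsymm hAker hb hfm
        (measurable_const : Measurable fun _ : GaugeConfig 3 N G => (1 : ℝ)) hfb hone hX1 M
      have hcoef : ∀ i, lam i ^ (M + 2) * ⟪b i, X1 (b i)⟫ = lam i ^ (M + 1 + 2) * πc i := by
        intro i
        rw [inner_fgOp_one_eq (μ := μ) hAker hb hX1 i]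
        ring
      simp_rw [hcoef, mul_one] at hS
      unfold sliceMass
      rw [cyclicExpectation_eq]
      exact ratio_eq_of_hasSum hL0.ne' hlamr (M + 1 + 2) hS (hZ (M + 1))
    -- the lag-`(r+1)` stay probability at temporal extent `M + r + 3`
    have hstay : ∀ M : ℕ, sliceStayN ρ β N (M + r + 1 + 2) (r + 1) Aset =
        (lam₀ ^ (r + 1))⁻¹ * ((∑' i, rr i ^ (M + 2) * qc i) / (∑' i, rr i ^ (M + 2 + (r + 1)))) := by
      intro M
      -- the insertion site
      set q : Fin (M + r + 1 + 2) := ((r + 1 : ℕ) : ZMod (M + r + 1 + 2)) with hq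
      have hqv : (q : ℕ) = r + 1 := by
        have h1 : ZMod.val (((r + 1 : ℕ) : ZMod (M + r + 1 + 2))) = (r + 1) % (M + r + 1 + 2) :=
          ZMod.val_natCast _ (r + 1)
        rw [Nat.mod_eq_of_lt (by omega)] at h1
        exact h1
      have hc : M + 1 + 1 + r + 1 = M + r + 1 + 2 := by omega
      set p : Fin (M + 1 + 1 + r + 1) := Fin.cast hc.symm q with hp
      have hpv : (p : ℕ) = r + 1 := by rw [hp, Fin.val_cast, hqv]
      have hS := hasSum_cyclic_insert_lag (μ := μ) hK hC hsymm hAker hb hK0 hKs hfm hfm hfb hfb r hXn M p hpv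
      have hcast := integral_cyclic_cast_lag μ hc K f f p
      have hpq : Fin.cast hc p = q := by rw [hp]; exact Fin.ext rfl
      rw [hpq] at hcast
      rw [← hcast] at hS
      have hdef : sliceStayN ρ β N (M + r + 1 + 2) (r + 1) Aset =
          (∫ V : Fin (M + r + 1 + 2) → GaugeConfig 3 N G, (∏ t, K (V t) (V (t + 1))) * (f (V 0) * f (V q))
            ∂(Measure.pi fun _ => μ)) / cyclicPartition ρ β N (M + r + 1 + 2) := rfl
      have hre : (∫ V : Fin (M + r + 1 + 2) → GaugeConfig 3 N G, (∏ t, K (V t) (V (t + 1))) *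
            (f (V 0) * f (V q)) ∂(Measure.pi fun _ => μ)) =
          ∫ V : Fin (M + r + 1 + 2) → GaugeConfig 3 N G, f (V 0) * f (V q) * ∏ t, K (V t) (V (t + 1))
            ∂(Measure.pi fun _ => μ) := by
        refine integral_congr_ae (Eventually.of_forall fun V => ?_)
        ring
      rw [hdef, hre]
      have hZ' : HasSum (fun i => lam i ^ (M + 2 + (r + 1))) (cyclicPartition ρ β N (M + r + 1 + 2)) := by
        have e : (fun i : s => lam i ^ (M + 2 + (r + 1))) = fun i => lam i ^ (M + r + 1 + 2) :=
          funext fun i => by congr 1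
        rw [e]
        exact hZ (M + r + 1)
      exact ratio_eq_of_hasSum_add hL0.ne' hlamr (M + 2) (r + 1) hS hZ'
    -- the limits `m → ∞`
    have hTπ : Tendsto (fun M : ℕ => ∑' i, rr i ^ (M + 1 + 2) * πc i) atTop (𝓝 (πc i₀)) :=
      (tendsto_tsum_pow_mul hr0 hri₀ hϑ1 hrϑ hrsum hπb).comp (tendsto_add_atTop_nat 1)
    have hT1 : Tendsto (fun M : ℕ => ∑' i, rr i ^ (M + 1 + 2)) atTop (𝓝 1) := by
      have h1 := (tendsto_tsum_pow_mul (c := fun _ => (1 : ℝ)) (B := 1) hr0 hri₀ hϑ1 hrϑ hrsum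
        (fun _ => by simp)).comp (tendsto_add_atTop_nat 1)
      refine h1.congr fun M => ?_
      simp only [Function.comp_apply, mul_one]
    have hT1r : Tendsto (fun M : ℕ => ∑' i, rr i ^ (M + 2 + (r + 1))) atTop (𝓝 1) := by
      have h1 := (tendsto_tsum_pow_mul (c := fun _ => (1 : ℝ)) (B := 1) hr0 hri₀ hϑ1 hrϑ hrsum
        (fun _ => by simp)).comp (tendsto_add_atTop_nat (r + 1))
      refine h1.congr fun M => ?_
      simp only [Function.comp_apply, mul_one]
      refine tsum_congr fun i => ?_
      congr 1; omega
    have hTq : Tendsto (fun M : ℕ => ∑' i, rr i ^ (M + 2) * qc i) atTop (𝓝 (qc i₀)) :=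
      tendsto_tsum_pow_mul hr0 hri₀ hϑ1 hrϑ hrsum hqb
    have hTmass : Tendsto (fun M : ℕ => sliceMass ρ β N (M + 1 + 2) Aset) atTop (𝓝 (πc i₀)) := by
      have := hTπ.div hT1 one_ne_zero
      rw [div_one] at this
      exact this.congr fun M => (hmass M).symm
    have hTmass' : Tendsto (fun M : ℕ => sliceMass ρ β N (M + r + 1 + 2) Aset) atTop (𝓝 (πc i₀)) := by
      have := hTmass.comp (tendsto_add_atTop_nat r)
      refine this.congr fun M => ?_
      simp only [Function.comp_apply]
    have hTstay : Tendsto (fun M : ℕ => sliceStayN ρ β N (M + r + 1 + 2) (r + 1) Aset) atTop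
        (𝓝 ((lam₀ ^ (r + 1))⁻¹ * qc i₀)) := by
      have := (hTq.div hT1r one_ne_zero).const_mul (lam₀ ^ (r + 1))⁻¹
      rw [div_one] at this
      exact this.congr fun M => (hstay M).symm
    have hlim : k * (πc i₀ * (1 - πc i₀)) ≤ πc i₀ - (lam₀ ^ (r + 1))⁻¹ * qc i₀ := by
      refine le_of_tendsto_of_tendsto ((hTmass'.mul (tendsto_const_nhds.sub hTmass')).const_mul k) (hTmass'.sub hTstay) ?_
      rw [EventuallyLE, eventually_atTop]
      exact ⟨m₀, fun M hM => hm₀ (M + r + 1) (by omega)⟩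
    -- identification of the limits with the ground state
    have hπ₀ : πc i₀ = ∫ x in Aset, h x ^ 2 ∂μ := by
      have h1 : πc i₀ = ∫ x, f x * h x ^ 2 ∂μ := by
        refine integral_congr_ae ?_
        filter_upwards [hbε] with x hx
        rw [hx, mul_pow, hε2, one_mul]
      rw [h1, ← integral_indicator hAset]
      refine integral_congr_ae (Eventually.of_forall fun x => ?_)
      rcases hf01 x with h0 | h0
      · have hx : x ∉ Aset := by
          intro hx; simp [hf, hx] at h0
        simp [h0, hx]
      · have hx : x ∈ Aset := by
          by_contra hx; simp [hf, hx] at h0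
        simp [h0, hx]
    have hq₀ : qc i₀ = ∫ x in Aset, ∫ y in Aset, h x * Kn r x y * h y ∂μ ∂μ := by
      have h1 : qc i₀ = ∫ x, f x * b i₀ x * ∫ y, Kn r x y * (f y * b i₀ y) ∂μ ∂μ :=
        inner_lagOp_eq (μ := μ) (b := b) hXn i₀
      have h2 : ∀ x, ∫ y, Kn r x y * (f y * b i₀ y) ∂μ = ∫ y, Kn r x y * (f y * (ε * h y)) ∂μ := fun x =>
        integral_congr_ae (by filter_upwards [hbε] with y hy; rw [hy])
      rw [h1]
      simp_rw [h2]
      have h3 : ∫ x, f x * b i₀ x * ∫ y, Kn r x y * (f y * (ε * h y)) ∂μ ∂μ =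
          ∫ x, f x * (ε * h x) * ∫ y, Kn r x y * (f y * (ε * h y)) ∂μ ∂μ :=
        integral_congr_ae (by filter_upwards [hbε] with x hx; rw [hx])
      rw [h3, ← integral_indicator hAset]
      refine integral_congr_ae (Eventually.of_forall fun x => ?_)
      have hin : ∫ y, Kn r x y * (f y * (ε * h y)) ∂μ = ε * ∫ y in Aset, Kn r x y * h y ∂μ := by
        rw [← integral_indicator hAset, ← integral_const_mul]
        refine integral_congr_ae (Eventually.of_forall fun y => ?_)
        by_cases hy : y ∈ Aset
        · simp [hf, hy]; ring
        · simp [hf, hy]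
      dsimp only
      rw [hin]
      by_cases hx : x ∈ Aset
      · simp only [hf, hx, Set.indicator_of_mem, one_mul]
        have : ε * h x * (ε * ∫ y in Aset, Kn r x y * h y ∂μ) = ε ^ 2 * (h x * ∫ y in Aset, Kn r x y * h y ∂μ) := by ring
        rw [this, hε2, one_mul, ← integral_const_mul]
        refine integral_congr_ae (Eventually.of_forall fun y => ?_); ring
      · simp [hf, hx]
    rw [hπ₀, hq₀] at hlim
    linarith [hlim]
  -- STEP 2: the excited spectrum of the `n`-step chain
  set U : ℝ := max (1 - k ^ 2 / 8) 0 with hU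
  have hU0 : 0 ≤ U := le_max_right _ _
  set u : ℝ := U ^ ((1 : ℝ) / ((r + 1 : ℕ) : ℝ)) with hu
  have hu0 : 0 ≤ u := Real.rpow_nonneg hU0 _
  have hru : ∀ i, i ≠ i₀ → rr i ≤ u := by
    intro i hi
    by_cases hli : lam i = 0
    · rw [hr]; simp only; rw [hli, zero_div]; exact hu0
    · have hlipos : 0 < lam i := lt_of_le_of_ne (hlam0 i) (Ne.symm hli)
      have h1 := eigenvalue_le_of_conductance (μ := μ) hKn' hKnb hsymmn hKnnn hhm hhB hh₀ hlow hL0n heign hnorm hk hconduct hAkern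
        (pow_apply_basis hb (r + 1) i) (pow_pos hlipos _) (b.orthonormal.norm_eq_one i) (horth i hi)
      -- `(λᵢ/λ₀)^{r+1} ≤ 1 − k²/8 ≤ U`
      have h2 : rr i ^ (r + 1) ≤ U := by
        have : rr i ^ (r + 1) = lam i ^ (r + 1) / lam₀ ^ (r + 1) := by rw [hr]; simp only; rw [div_pow]
        rw [this, div_le_iff₀ hL0n]
        calc lam i ^ (r + 1) ≤ lam₀ ^ (r + 1) * (1 - k ^ 2 / 8) := h1
          _ ≤ U * lam₀ ^ (r + 1) := by rw [mul_comm]; exact mul_le_mul_of_nonneg_right (le_max_left _ _) hL0n.le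
      exact le_rpow_inv_of_pow_le (hr0 i) hU0 (by omega) h2
  have huexp : u ≤ Real.exp (-(k ^ 2 / 8 / ((r + 1 : ℕ) : ℝ))) := by
    refine rpow_inv_le_exp hU0 (by omega) ?_
    refine max_le ?_ (Real.exp_pos _).le
    have := Real.add_one_le_exp (-(k ^ 2 / 8)); linarith
  -- STEP 3: the trace excess as the spectral sum off the top index
  have htr : ∀ m : ℕ, traceExcess ρ β N (m + 2) = ∑' i, (if i = i₀ then 0 else rr i ^ (m + 2)) := by
    intro m
    have h1 : HasSum (fun i => rr i ^ (m + 2)) (cyclicPartition ρ β N (m + 2) / lam₀ ^ (m + 2)) := by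
      have := (hZ m).div_const (lam₀ ^ (m + 2))
      refine this.congr_fun fun i => ?_
      rw [hlam_eq i (m + 2), mul_div_cancel_left₀ _ (pow_ne_zero _ hL0.ne')]
    have hsumm : Summable fun i => rr i ^ (m + 2) := h1.summable
    unfold traceExcess
    rw [hrad, ← h1.tsum_eq, hsumm.tsum_eq_add_tsum_ite i₀, hri₀, one_pow]
    ring
  set x₂ : ℝ := ∑' i, (if i = i₀ then 0 else rr i ^ 2) with hx₂
  refine ⟨x₂ * Real.exp (2 * (k ^ 2 / (8 * ((r : ℝ) + 1)))), fun m => ?_⟩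
  rw [htr m]
  have hterm : ∀ i, (if i = i₀ then 0 else rr i ^ (m + 2)) ≤ (if i = i₀ then 0 else rr i ^ 2) * u ^ m := by
    intro i
    split_ifs with hi
    · simp
    · rw [pow_add, mul_comm]
      exact mul_le_mul_of_nonneg_left (pow_le_pow_left₀ (hr0 i) (hru i hi) m) (sq_nonneg _)
  have hsum1 : Summable fun i => (if i = i₀ then 0 else rr i ^ 2) := by
    refine Summable.of_nonneg_of_le (fun i => ?_) (fun i => ?_) hrsum
    · split_ifs <;> positivity
    · split_ifs <;> [exact sq_nonneg _; exact le_rfl]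
  have hsum2 : Summable fun i => (if i = i₀ then 0 else rr i ^ (m + 2)) := by
    refine Summable.of_nonneg_of_le (fun i => ?_) hterm (hsum1.mul_right _)
    split_ifs
    · exact le_rfl
    · exact pow_nonneg (hr0 i) _
  have hx₂0 : 0 ≤ x₂ := tsum_nonneg fun i => by
    split_ifs
    · exact le_rfl
    · exact sq_nonneg _
  have hrate : Real.exp (-(k ^ 2 / 8 / ((r + 1 : ℕ) : ℝ))) = Real.exp (-(k ^ 2 / (8 * ((r : ℝ) + 1)))) := by
    have e : ((r + 1 : ℕ) : ℝ) = (r : ℝ) + 1 := by push_cast; ring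
    rw [e, div_div]
  calc ∑' i, (if i = i₀ then 0 else rr i ^ (m + 2)) ≤ ∑' i, (if i = i₀ then 0 else rr i ^ 2) * u ^ m :=
        Summable.tsum_le_tsum hterm hsum2 (hsum1.mul_right _)
    _ = x₂ * u ^ m := tsum_mul_right
    _ ≤ x₂ * Real.exp (-(k ^ 2 / (8 * ((r : ℝ) + 1)))) ^ m := by
        rw [← hrate]; exact mul_le_mul_of_nonneg_left (pow_le_pow_left₀ hu0 huexp m) hx₂0
    _ = x₂ * Real.exp (2 * (k ^ 2 / (8 * ((r : ℝ) + 1)))) *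
          Real.exp (-(k ^ 2 / (8 * ((r : ℝ) + 1)) * ((m + 2 : ℕ) : ℝ))) := by
        rw [← Real.exp_nat_mul, mul_assoc, ← Real.exp_add]
        congr 1; congr 1; push_cast; ring

end PerTorus

end Summit.QuantumFields.YangMills.Cruxes.IR.VacuumEscape

end
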